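import Summits.ResolutionOfSingularities.ResolutionOfSingularities.Theorems.WildLogDiagonalLU5
import Literature.AlgebraicGeometry.Resolution.RegularSystemOfParameters
import HarnessLib

/-!
# WildTwistedToricLU — decomp-res node «TwistedToricCut» (lens-1 g33, door (W-λ′) of ROW 239), tree file 1/7

ERRATUM to `Theorems/WildLogDiagonalLU.lean` §3 (c), §4 (4c) and to the docstrings of
`WildLogDiagonalUnluckyAbove` / `WildLogDiagonalMixedAbove` / R33 (census-1 instrument I176, 2026-08-31): (1) the
census (c) unit datum `g x₂ = x₂(1 + η + η²x₃)` and the λ′/λ″ "first instances" with a `g`-FIXED unit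
(`g η₁ = η₁(1 + η₂)`, `g x₁ = x₁(1 + η)²(1 + η + η²x₃)`) are NOT order-`p` actions (a `g`-fixed unit `u` with
`u^p = 1` equals `1` in characteristic `p`) — withdrawn; the genuine instances are: λ′ — the registry control
`g η = η/(1 + η)`, `g u = u`, `v(u), v(η) = 1, [0;3,1̄]`, `p = 5` (∘ a non-Abhyankar arc for `d ≥ 3`) and its rank-3
twin `c = 1` on the Jacobi ladder `(1, ∛2, ∛4)` (never lucky for `p ∈ {3,5,7,11,13}`); census (c) / λ″ — the
TWO-PIVOT top `g x₁ = x₁/(1 + x₁)`, `g x₂ = x₂/(1 + x₂)`, `g x₃ = x₃` (frame units multiplicatively independent,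
`⟨u_j⟩` a monomial-chart invariant ⇒ no chart of any depth is binomial; "mixed" is read modulo unit rescalings
`x′_j ↦ x′_j φ`, which change `u_j` by the coboundary `g φ/φ`; the intrinsic test is principality of the
augmentation ideal — pseudo-reflection charts EXIST for the two-pivot top on `(1, √2, √3)`, `p = 3`, depths 2–4,
none ≤ 7 on the Jacobi ladder); (2) (4c) is a DEPTH-0 certificate of the Lucky clause; cofinality of lucky frames
depends on the value vector (Jacobi ladder, `(p, c) = (7, 49)`: lucky depths `{0, 1}` only — not an inhabitant;
tribonacci ladder, `(7, 7)`: cofinal — an inhabitant, rr 3). No Lean statement of g32 is affected.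

## The node

THE LAW OF THE UNLUCKY BINOMIAL KIND λ′ (tree file 6/7, `relLU_of_wildLogDiagonalUnluckyAbove :
WildLogDiagonalUnluckyAbove k O → RelLocalUniformization k K O`, hypothesis-free, every `d`, every `p`) by the
FROBENIUS / HILBERT-90-TWISTED TORIC QUOTIENT.  Upstairs `B = M_𝔪′` is regular local with r.s.p. `x`, and the
generator `σ` of `G = ℤ/p` acts LOG-DIAGONALLY with ONE principal unit: `σ xᵢ = xᵢ u^{Nᵢ}`, `u = 1 + η`.
(a) NORM ONE `∏_{i<p} σ^i u = 1` (a principal unit root of unity is `1` in characteristic `p`); (b) the HILBERT-90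
UNIT `Φ = ∏_{i<p} (σ^i u)^i`, `σ Φ = Φ u^p`; (c) TWISTED MONOMIALS `z_β = x^β Φ^{−⟨β,N⟩/p}` on the index-`p` lattice
`L = {β : p ∣ ⟨β,N⟩}` are `σ`-invariant («crypto-tame»: `N mod p` is the character, `Φ` the Kummer twist);
(d) STRUCTURE THEOREM (this file and file 2/7): the maximal ideal of the ring of invariants `A = B^σ` is generated
by the `z_β`, `β ∈ ℕ^d ∩ L ∖ 0` — PEEL by initial forms (the derivation `D = σ − 1` has `D(B) ⊆ η𝔪`; `D f = 0` and
quasi-regularity of the r.s.p., Matsumura 17.10, force the degree-`n` form of an invariant to live on `L`), then an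
Artin–Rees TAIL and Nakayama; (e) the TORIC CHART of the lattice (tree `exists_toricChart_of_addSubgroup`,
`isRegularLocalRing_locAtCentre_adjoin_monomials`) resolves the (singular!) quotient DOWNSTAIRS — no
pseudo-reflection is needed (there is none: registry control `γ = [0;3,1̄]`, `p = 5`, toy quotient `A_{p−1}`).

## Files, honest scope, non-vacuity

FILES (7, linear imports, each ≤ 400 l): 1/7 algebra I (unit-power expansions, twisted monomials `twMono`, the
PEEL `exists_peel`) · 2/7 algebra II (the Artin–Rees TAIL `exists_tail`, the STRUCTURE THEOREM
`maximalIdeal_eq_span_twMono`) · 3/7 field currency I (NORM ONE `norm_eq_one`, the Hilbert-90 twist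
`apply_twistUnit`, the derivation rule `exists_apply_sub_eq_eta_mul`) · 4/7 field currency II (the two local rings
`A = (M ⊓ K)_𝔪′ ⊆ B = M_𝔪′`: `finite_inclusion_locAtCentre_inf`, `ringKrullDim_locAtCentre_inf_eq`,
`maximalIdeal_locAtCentre_inf_eq_span`) · 5/7 THE ENGINE `exists_twisted_toric_chart` (lattice basis + toric chart of
the invariant lattice, tree theorems BY NAME) · 6/7 THE LAW `relLU_of_wildLogDiagonalUnluckyAbove` (+ the FQ control
and g32's cell re-decided through the landed inclusion `wildLogDiagonalUnluckyAbove_of_wildLogDiagonalLUAbove`) ·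
7/7 kernel TOY DATA `p = 2, 3`, the located residual `R34`, the ONE cut `R33 ↔ R34`, `closes_twistedToric`.
HONEST SCOPE: `λ′ = WildLogDiagonalUnluckyAbove` is DECIDED (every `d`, every `p`, no luck / arithmetic clause);
`λ″ = WildLogDiagonalMixedAbove` (two-pivot / mixed units, cocycle of rank ≥ 2) is UNDECIDED and untouched; nothing
is claimed about [KiralyLutkebohmert2013, Conj. 10]; the invariant ring `B^σ` is NOT claimed regular (it is not:
the toy quotient is `A_{p−1}`) — the law produces a REGULAR MODEL BELOW by a toric chart of the invariant lattice;
`R34 := R33 ∧ ¬λ′` is a CANDIDATE genuine narrowing of the class of places (`¬λ′` is not implied by R33's binders),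
nothing more.  NON-VACUITY: `λ′` is inhabited by reference — the registry control `p = 5`, `γ = [0;3,1̄]`
(`control_not_lucky`, ROW 239 (w5)), on which g32's cell fails on every monomial chart; KERNEL toy data on the
depth-1 control `B′ = k[η,u₁]` for `p = 2` AND `p = 3`: `toy_norm_two` / `toy_norm_three` (`N(u) = 1`),
`toy_twistUnit_two` / `toy_twistUnit_three` (`σΦ = Φu^p`), `toy_U_invariant`, `toy_s_invariant`, `toy_n_invariant`,
`toy_relation` (`U^p = sn`) — paper: `B′^σ = k[s,n,U]/(U^p − sn) = A_{p−1}`.  CREDIT: the law is the one object;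
engine, structure theorem, toy, cut and `closes_twistedToric` are 0-weight tools / bookkeeping.

## This file (abstract commutative algebra, any commutative ring `R`)

§A1 second-order expansions of unit powers; §A2 twisted monomials and their invariance; §A3 THE PEEL LEMMA
`exists_peel` over a regular local domain `R` with r.s.p. `x`, ring endomorphism `σ`, units `u = 1 + η`, `Φ`.

(Sources: Matsumura1987 Thm. 17.10 (tree `coeff_mem_maximalIdeal_of_eval_mem_pow`); Hilbert's Satz 90 for cyclic
groups, folklore — nearest print Peskin1983 Thm. 3.8 (norm-one unit cocycles split when the invariant ring is
factorial; here the splitting `Φ` is explicit and unconditional); CossartPiltant2008 proof of Lemma 9.4 (53)–(54)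
and Fulton1993Toric §2.6 for the toric chart; KiralyLutkebohmert2013 Thm. 2 for why λ′ has no pseudo-reflection
chart; tree: WildLogDiagonalLU 1–5 (g32).)
-/

noncomputable section

open IsLocalRing MvPolynomial Literature.AlgebraicGeometry.Resolution

universe u

namespace Summit.ResolutionOfSingularities.ResolutionOfSingularities.Theorems.WildTwistedToricLU

section Expansion

variable {R : Type u} [CommRing R]

/-- `(1 + η)^m = 1 + m η + η² e`. [folklore] -/
theorem exists_one_add_pow_eq (η : R) (m : ℕ) : ∃ e : R, (1 + η) ^ m = 1 + (m : R) * η + η ^ 2 * e := by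
  induction m with
  | zero => exact ⟨0, by simp⟩
  | succ m ih =>
    obtain ⟨e, he⟩ := ih
    refine ⟨(1 + η) * e + (m : R), ?_⟩
    rw [pow_succ, he]
    push_cast
    ring

/-- `u^m = 1 + m η + η² e` for a unit `u = 1 + η` and `m ∈ ℤ`. [folklore] -/
theorem exists_units_zpow_eq (u : Rˣ) (η : R) (hu : (u : R) = 1 + η) (m : ℤ) :
    ∃ e : R, ((u ^ m : Rˣ) : R) = 1 + (m : R) * η + η ^ 2 * e := by
  cases m with
  | ofNat n =>
    obtain ⟨e, he⟩ := exists_one_add_pow_eq η n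
    refine ⟨e, ?_⟩
    rw [Int.ofNat_eq_natCast, zpow_natCast, Units.val_pow_eq_pow_val, hu, he]
    push_cast
    ring
  | negSucc n =>
    set w : R := ((u⁻¹ : Rˣ) : R) with hw
    have hw1 : w * (1 + η) = 1 := by rw [hw, ← hu, Units.inv_mul]
    obtain ⟨e, he⟩ := exists_one_add_pow_eq (w - 1) (n + 1)
    rw [add_sub_cancel] at he
    refine ⟨(n + 1 : R) * w + w ^ 2 * e, ?_⟩
    rw [zpow_negSucc, ← inv_pow, Units.val_pow_eq_pow_val, ← hw, he, Int.cast_negSucc]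
    push_cast
    have hw2 : w - 1 = -(w * η) := by linear_combination hw1
    rw [hw2]
    linear_combination (-((n : R) + 1) * η) * hw1

/-- `Φ ≡ 1 (mod I)` implies `Φ^k ≡ 1 (mod I)` for every `k ∈ ℤ`. [folklore] -/
theorem units_zpow_sub_one_mem (I : Ideal R) (Φ : Rˣ) (h : (Φ : R) - 1 ∈ I) (k : ℤ) :
    ((Φ ^ k : Rˣ) : R) - 1 ∈ I := by
  have key : ∀ (w : R), w - 1 ∈ I → ∀ n : ℕ, w ^ n - 1 ∈ I := fun w hw n => by
    obtain ⟨q, hq⟩ := sub_dvd_pow_sub_pow w 1 n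
    rw [one_pow] at hq
    rw [hq]
    exact I.mul_mem_right _ hw
  cases k with
  | ofNat n =>
    rw [Int.ofNat_eq_natCast, zpow_natCast, Units.val_pow_eq_pow_val]
    exact key _ h n
  | negSucc n =>
    rw [zpow_negSucc, ← inv_pow, Units.val_pow_eq_pow_val]
    refine key _ ?_ _
    have e : ((Φ⁻¹ : Rˣ) : R) - 1 = -(((Φ⁻¹ : Rˣ) : R) * ((Φ : R) - 1)) := by
      rw [mul_sub, Units.inv_mul, mul_one]; ring
    rw [e]
    exact I.neg_mem (I.mul_mem_left _ h)

/-- An integer prime to `p` is a unit in a ring with `p = 0`. [folklore] -/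
theorem isUnit_intCast_of_not_dvd {p : ℕ} (hp : p.Prime) (hpR : (p : R) = 0) {m : ℤ}
    (hm : ¬ (p : ℤ) ∣ m) : IsUnit (m : R) := by
  have hirr : Irreducible (p : ℤ) := (Nat.prime_iff_prime_int.mp hp).irreducible
  obtain ⟨a, b, hab⟩ := (hirr.coprime_iff_not_dvd).mpr hm
  have h : (b : R) * (m : R) = 1 := by
    have := congrArg (Int.cast : ℤ → R) hab
    push_cast at this
    rw [hpR, mul_zero, zero_add] at this
    exact this
  exact IsUnit.of_mul_eq_one_right _ h

/-- `∏ a^{f i} = a^{∑ f i}` for integer exponents in a commutative group. [folklore] -/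
theorem prod_zpow_eq_zpow_sum' {G : Type*} [CommGroup G] {ι : Type*} (a : G) (s : Finset ι) (f : ι → ℤ) :
    ∏ i ∈ s, a ^ f i = a ^ ∑ i ∈ s, f i := by
  classical
  induction s using Finset.induction_on with
  | empty => simp
  | insert i s hi ih => rw [Finset.prod_insert hi, Finset.sum_insert hi, ih, zpow_add]

end Expansion

section Twist

variable {R : Type u} [CommRing R] {d : ℕ}

/-- The pairing `⟨β, N⟩ = ∑ⱼ Nⱼ βⱼ` of an exponent vector with the twist vector. -/
def pair (N : Fin d → ℤ) (β : Fin d →₀ ℕ) : ℤ := ∑ j, N j * (β j : ℤ)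

/-- The monomial `x^β = ∏ⱼ xⱼ^{βⱼ}`. -/
def mono (x : Fin d → R) (β : Fin d →₀ ℕ) : R := ∏ j, x j ^ (β j)

/-- THE TWISTED MONOMIAL `z_β = x^β · Φ^{−⟨β,N⟩/p}` (meaningful for `p ∣ ⟨β,N⟩`). -/
def twMono (x : Fin d → R) (Φ : Rˣ) (N : Fin d → ℤ) (p : ℕ) (β : Fin d →₀ ℕ) : R :=
  mono x β * ((Φ ^ (-(pair N β / p)) : Rˣ) : R)

/-- The pairing is additive in the exponent. -/
theorem pair_add (N : Fin d → ℤ) (β γ : Fin d →₀ ℕ) : pair N (β + γ) = pair N β + pair N γ := by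
  simp only [pair, Finsupp.coe_add, Pi.add_apply, Nat.cast_add, mul_add, Finset.sum_add_distrib]

/-- Monomials are multiplicative in the exponent. -/
theorem mono_add (x : Fin d → R) (β γ : Fin d →₀ ℕ) : mono x (β + γ) = mono x β * mono x γ := by
  simp only [mono, Finsupp.coe_add, Pi.add_apply, pow_add, Finset.prod_mul_distrib]

/-- `z_{β+γ} = z_β z_γ` as soon as `p ∣ ⟨β,N⟩`. -/
theorem twMono_add (x : Fin d → R) (Φ : Rˣ) (N : Fin d → ℤ) {p : ℕ} (hp : 0 < p) {β : Fin d →₀ ℕ}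
    (hβ : (p : ℤ) ∣ pair N β) (γ : Fin d →₀ ℕ) :
    twMono x Φ N p (β + γ) = twMono x Φ N p β * twMono x Φ N p γ := by
  have hp0 : (p : ℤ) ≠ 0 := by exact_mod_cast hp.ne'
  rw [twMono, twMono, twMono, mono_add, pair_add, Int.add_ediv_of_dvd_left hβ, neg_add, zpow_add,
    Units.val_mul]
  ring

/-- `eval x (monomial β a) = a · x^β`. -/
theorem eval_monomial_eq (x : Fin d → R) (β : Fin d →₀ ℕ) (a : R) :
    eval x (monomial β a) = a * mono x β := by
  rw [eval_monomial, mono, Finsupp.prod_fintype _ _ (fun i => pow_zero (x i))]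

/-- `x^β ∈ (x)^{|β|}`. -/
theorem mono_mem_pow (x : Fin d → R) (β : Fin d →₀ ℕ) :
    mono x β ∈ Ideal.span (Set.range x) ^ β.degree := by
  have h := eval_mem_span_pow x (isHomogeneous_monomial (σ := Fin d) (R := R) (d := β) 1 rfl)
  rwa [eval_monomial_eq, one_mul] at h

variable (x : Fin d → R) (σ : R →+* R) (u Φ : Rˣ) (N : Fin d → ℤ) (p : ℕ)

/-- `σ (x^β) = x^β · u^{⟨β,N⟩}` for a log-diagonal `σ`. -/
theorem apply_mono (hσx : ∀ j, σ (x j) = x j * ((u ^ N j : Rˣ) : R)) (β : Fin d →₀ ℕ) :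
    σ (mono x β) = mono x β * ((u ^ pair N β : Rˣ) : R) := by
  simp only [mono, map_prod, map_pow, hσx, mul_pow, Finset.prod_mul_distrib, pair]
  congr 1
  rw [← prod_zpow_eq_zpow_sum', Units.coe_prod]
  refine Finset.prod_congr rfl fun j _ => ?_
  rw [← Units.val_pow_eq_pow_val, ← zpow_natCast, ← zpow_mul]

/-- `σ (Φ^k) = Φ^k u^{pk}` when `σ Φ = Φ u^p`. -/
theorem apply_units_zpow (hσΦ : σ (Φ : R) = (Φ : R) * ((u ^ (p : ℤ) : Rˣ) : R)) (k : ℤ) :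
    σ ((Φ ^ k : Rˣ) : R) = ((Φ ^ k : Rˣ) : R) * ((u ^ ((p : ℤ) * k) : Rˣ) : R) := by
  have h1 : Units.map (σ : R →* R) Φ = Φ * u ^ (p : ℤ) := Units.ext (by
    rw [Units.coe_map, Units.val_mul]; exact hσΦ)
  have h2 : σ ((Φ ^ k : Rˣ) : R) = ((Units.map (σ : R →* R) (Φ ^ k) : Rˣ) : R) := by
    rw [Units.coe_map]; rfl
  rw [h2, map_zpow, h1, mul_zpow, ← zpow_mul, Units.val_mul]

/-- INVARIANCE of the twisted monomials: `σ z_β = z_β` for `p ∣ ⟨β,N⟩`. -/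
theorem apply_twMono (hσx : ∀ j, σ (x j) = x j * ((u ^ N j : Rˣ) : R))
    (hσΦ : σ (Φ : R) = (Φ : R) * ((u ^ (p : ℤ) : Rˣ) : R)) {β : Fin d →₀ ℕ} (hβ : (p : ℤ) ∣ pair N β) :
    σ (twMono x Φ N p β) = twMono x Φ N p β := by
  obtain ⟨q, hq⟩ := hβ
  by_cases hp0 : (p : ℤ) = 0
  · -- degenerate `p = 0`: then `⟨β,N⟩ = 0`
    rw [hp0, zero_mul] at hq
    rw [twMono, map_mul, apply_mono x σ u N hσx, hq, hp0, Int.ediv_zero, neg_zero, zpow_zero, zpow_zero,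
      Units.val_one, map_one, mul_one]
  rw [twMono, map_mul, apply_mono x σ u N hσx, apply_units_zpow σ u Φ p hσΦ, hq,
    Int.mul_ediv_cancel_left _ hp0, mul_neg, mul_mul_mul_comm, ← Units.val_mul, ← zpow_add,
    add_neg_cancel, zpow_zero, Units.val_one, mul_one]

end Twist

section Peel

variable {R : Type u} [CommRing R] [IsDomain R] [IsRegularLocalRing R] {d : ℕ}

/-- THE PEEL LEMMA (initial forms of invariants live on the index-`p` lattice).  Let `R` be a regular
local domain with r.s.p. `x`, `σ` a ring endomorphism acting log-diagonally `σ xⱼ = xⱼ u^{Nⱼ}` with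
`u = 1 + η`, `η ∈ 𝔪 ∖ 0`, such that the derivation `σ − 1` takes values in `η𝔪`, `p = 0` in `R`, `Φ ≡ 1`
a unit, and `C` a set of "constants" representing all residues.  If `σ f = f` and `f ∈ 𝔪ⁿ` then
`f ≡ Σ_{β ∈ L, |β| = n} c_β z_β (mod 𝔪ⁿ⁺¹)` with `c_β ∈ C`, `z_β = x^β Φ^{−⟨β,N⟩/p}` the twisted monomials.
Mechanism: `0 = (σ f − f)/η = Σ_β x^β (c_β ⟨β,N⟩ + 𝔪)`, and quasi-regularity of the r.s.p.
(Matsumura 17.10, tree `coeff_mem_maximalIdeal_of_eval_mem_pow`) forces `c_β ⟨β,N⟩ ∈ 𝔪`.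
[cite: Matsumura1987, Thm. 17.10; this node] -/
theorem exists_peel (hd : (maximalIdeal R).spanFinrank = d) (x : Fin d → R)
    (hx : Ideal.span (Set.range x) = maximalIdeal R) (σ : R →+* R) (u Φ : Rˣ) (N : Fin d → ℤ)
    {p : ℕ} (hp : p.Prime) (hpR : (p : R) = 0) (η : R) (hu : (u : R) = 1 + η)
    (hη : η ∈ maximalIdeal R) (hη0 : η ≠ 0) (hΦ1 : (Φ : R) - 1 ∈ maximalIdeal R)
    (hσx : ∀ j, σ (x j) = x j * ((u ^ N j : Rˣ) : R))
    (hD : ∀ b : R, ∃ m ∈ maximalIdeal R, σ b - b = η * m)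
    (C : Set R) (hres : ∀ b : R, ∃ c ∈ C, b - c ∈ maximalIdeal R)
    {n : ℕ} {f : R} (hσf : σ f = f) (hf : f ∈ maximalIdeal R ^ n) :
    ∃ (s : Finset (Fin d →₀ ℕ)) (c : (Fin d →₀ ℕ) → R),
      (∀ β ∈ s, β.degree = n ∧ (p : ℤ) ∣ pair N β ∧ c β ∈ C) ∧
      f - ∑ β ∈ s, c β * twMono x Φ N p β ∈ maximalIdeal R ^ (n + 1) := by
  classical
  obtain ⟨P, hPhom, hPf⟩ := exists_isHomogeneous_of_mem_span_pow x n (by rwa [hx])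
  choose m hm hσm using fun β : Fin d →₀ ℕ => hD (P.coeff β)
  choose E hE using fun β : Fin d →₀ ℕ => exists_units_zpow_eq u η hu (pair N β)
  choose c hcC hc using fun β : Fin d →₀ ℕ => hres (P.coeff β)
  have hdeg : ∀ β ∈ P.support, β.degree = n := fun β hβ => by
    rw [Finsupp.degree_eq_weight_one]; exact hPhom (mem_support_iff.mp hβ)
  have hfsum : f = ∑ β ∈ P.support, P.coeff β * mono x β := by
    rw [← hPf]
    conv_lhs => rw [P.as_sum]
    rw [map_sum]
    exact Finset.sum_congr rfl fun β _ => eval_monomial_eq x β _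
  -- the coefficient of `x^β` in `(σ f − f)/η`
  set g : (Fin d →₀ ℕ) → R := fun β =>
    P.coeff β * ((pair N β : R) + η * E β) + m β * ((u ^ pair N β : Rˣ) : R) with hg
  have hterm : ∀ β, σ (P.coeff β * mono x β) - P.coeff β * mono x β = η * (mono x β * g β) := by
    intro β
    have h1 : σ (P.coeff β) = P.coeff β + η * m β := by rw [← hσm]; ring
    rw [map_mul, apply_mono x σ u N hσx, h1, hg]
    linear_combination (P.coeff β * mono x β) * hE β
  have hsum0 : η * ∑ β ∈ P.support, mono x β * g β = 0 := by
    rw [Finset.mul_sum]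
    simp_rw [← hterm]
    rw [Finset.sum_sub_distrib, ← map_sum, ← hfsum, hσf, sub_self]
  have hsum : ∑ β ∈ P.support, mono x β * g β = 0 := by
    rcases mul_eq_zero.mp hsum0 with h | h
    · exact absurd h hη0
    · exact h
  -- quasi-regularity of the r.s.p.
  set Q : MvPolynomial (Fin d) R := ∑ β ∈ P.support, monomial β (g β) with hQ
  have hQhom : Q.IsHomogeneous n :=
    IsHomogeneous.sum _ _ _ fun β hβ => isHomogeneous_monomial _ (hdeg β hβ)
  have hQeval : eval x Q = 0 := by
    rw [hQ, map_sum, ← hsum]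
    exact Finset.sum_congr rfl fun β _ => by rw [eval_monomial_eq, mul_comm]
  have hQcoeff : ∀ β ∈ P.support, Q.coeff β = g β := by
    intro β hβ
    rw [hQ, coeff_sum]
    simp_rw [coeff_monomial]
    rw [Finset.sum_ite_eq', if_pos hβ]
  have hgmem : ∀ β ∈ P.support, g β ∈ maximalIdeal R := by
    intro β hβ
    have := coeff_mem_maximalIdeal_of_eval_mem_pow hd x hx hQhom (by rw [hQeval]; exact zero_mem _) β
    rwa [hQcoeff β hβ] at this
  have hcp : ∀ β ∈ P.support, ¬ (p : ℤ) ∣ pair N β → P.coeff β ∈ maximalIdeal R := by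
    intro β hβ hnd
    have h1 : P.coeff β * (pair N β : R) ∈ maximalIdeal R := by
      have h2 : P.coeff β * (pair N β : R) =
          g β - η * (P.coeff β * E β) - m β * ((u ^ pair N β : Rˣ) : R) := by
        rw [hg]; ring
      rw [h2]
      exact sub_mem (sub_mem (hgmem β hβ) (Ideal.mul_mem_right _ _ hη))
        (Ideal.mul_mem_right _ _ (hm β))
    exact (Ideal.mul_unit_mem_iff_mem _ (isUnit_intCast_of_not_dvd hp hpR hnd)).mp h1
  refine ⟨P.support.filter (fun β => (p : ℤ) ∣ pair N β), c, ?_, ?_⟩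
  · intro β hβ
    rw [Finset.mem_filter] at hβ
    exact ⟨hdeg β hβ.1, hβ.2, hcC β⟩
  · rw [Finset.sum_filter, hfsum, ← Finset.sum_sub_distrib]
    refine Ideal.sum_mem _ fun β hβ => ?_
    have hMn : mono x β ∈ maximalIdeal R ^ n := by
      rw [← hdeg β hβ, ← hx]; exact mono_mem_pow x β
    split_ifs with hdiv
    · have e : P.coeff β * mono x β - c β * twMono x Φ N p β =
          (P.coeff β - c β) * mono x β -
            c β * (((Φ ^ (-(pair N β / p)) : Rˣ) : R) - 1) * mono x β := by
        rw [twMono]; ring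
      rw [e, pow_succ']
      exact sub_mem (Ideal.mul_mem_mul (hc β) hMn)
        (Ideal.mul_mem_mul (Ideal.mul_mem_left _ _ (units_zpow_sub_one_mem _ Φ hΦ1 _)) hMn)
    · rw [sub_zero, pow_succ']
      exact Ideal.mul_mem_mul (hcp β hβ hdiv) hMn

end Peel

end Summit.ResolutionOfSingularities.ResolutionOfSingularities.Theorems.WildTwistedToricLU

end
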